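import Literature.Geometry.Lorentzian.FinalState
import Literature.Geometry.Lorentzian.Genericity

/-!
# Route PhotonSphereChannels · crux `TameCensorship` (stmt-FinalStateConjecture-17431) · line `Sketch`, skeleton v4 ·
# stub `stub_robustAnd`: robust escapability is closed under conjunction

Helper file (`--supports stmt-FinalStateConjecture-17431`) of the reshaped line `Sketch` (lead c1, 2026-08-17). The
reshaped skeleton reduces K3 (`Theses.PhotonSphereChannels.TameCensorship`, TAME Christodoulou genericity of
"MGHD exists ∧ every MGHD has complete `𝓘⁺`, no extremal remnant, tame outer region") to CLAUSE-WISE stubs stated in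
the ROBUST (enrichment-stable, open-dense radial) form of route `RobustClausewiseGenericity`; this file is the first of
its three Lean-sized glue stubs: the `∧`-closure of that form, for two abstract properties `Q₁`, `Q₂`, stated without any
definition (the registered stub signature inlines the probe legend). Pure finite-dimensional bookkeeping.

References: B. R. Hunt, T. Sauer, J. A. Yorke, *Prevalence*, Bull. AMS 27 (1992), Fact 3″; D. Christodoulou, CQG 16
(1999) A23, p. A24.
-/

set_option linter.dupNamespace false

open Literature.Geometry.Lorentzian
open scoped Manifold ContDiff Topology
open Filter Set Function

noncomputable section

namespace Summit.FinalStateConjecture.FinalStateConjecture.Theorems.PhotonSphereChannels.TameCensorshipUnwind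

/-- **Stub `stub_robustAnd` of line `Sketch` (skeleton v4) for the crux `PhotonSphereChannels.TameCensorship`
(stmt-FinalStateConjecture-17431): robust escapability is CLOSED UNDER CONJUNCTION.** For an arbitrary datum `d` and two
properties `Q₁`, `Q₂` of initial data: if every compactly supported smooth admissible probe through `d` enriches (along an
injective linear map of parameter spaces) to one along all of whose further enrichments an open dense set of radial
directions has `Q₁` for all small non-zero parameters, and likewise for `Q₂`, then likewise for `Q₁ ∧ Q₂` — enrich for `Q₁`,
enrich the result for `Q₂`; a further enrichment of the second enriches the first along the composite linear map, so it
carries both open dense direction sets, whose intersection is open dense, with the smaller radius. This is the structural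
reason the reshaped line states the clauses of K3 robustly: plain (tame) curve-codimension is NOT closed under `∧`
(`Theorems/TameCensorship/Negative/TameGenericityAndFails.lean`). Same argument as
`Theorems.RobustClausewiseGenericity.RobustlyEscapable.and` (Hunt–Sauer–Yorke 1992, Fact 3″; Christodoulou 1999, p. A24),
stated DEF-FREE (the registered stub signature) so that it does not depend on that module's import cone. -/
theorem stub_robustAnd :
    ∀ (X : Type) [TopologicalSpace X] [ChartedSpace E3 X] [IsManifold (𝓡 3) ∞ X] [T2Space X]
    [SecondCountableTopology X] [ConnectedSpace X] (d : InitialDataSet (𝓡 3) X) (Q₁ Q₂ :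
    InitialDataSet (𝓡 3) X → Prop), (∀ (m : ℕ) (G : EuclideanSpace ℝ (Fin m) → InitialDataSet (𝓡 3)
    X), (InitialDataSet.IsSmoothDataFamily m G ∧ G 0 = d ∧ (∀ c, G c ∈ admissibleVacuumData X) ∧ ∃ K
    : Set X, IsCompact K ∧ ∀ c, ∀ x ∉ K, (G c).h.inner x = d.h.inner x ∧ (G c).k x = d.k x) → ∃ (n :
    ℕ) (G₁ : EuclideanSpace ℝ (Fin n) → InitialDataSet (𝓡 3) X) (L : EuclideanSpace ℝ (Fin m) →ₗ[ℝ]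
    EuclideanSpace ℝ (Fin n)), Function.Injective L ∧ (InitialDataSet.IsSmoothDataFamily n G₁ ∧ G₁ 0
    = d ∧ (∀ c, G₁ c ∈ admissibleVacuumData X) ∧ ∃ K : Set X, IsCompact K ∧ ∀ c, ∀ x ∉ K, (G₁
    c).h.inner x = d.h.inner x ∧ (G₁ c).k x = d.k x) ∧ (∀ c, G₁ (L c) = G c) ∧ ∀ (p : ℕ) (G₂ :
    EuclideanSpace ℝ (Fin p) → InitialDataSet (𝓡 3) X) (L' : EuclideanSpace ℝ (Fin n) →ₗ[ℝ]
    EuclideanSpace ℝ (Fin p)), Function.Injective L' → (InitialDataSet.IsSmoothDataFamily p G₂ ∧ G₂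
    0 = d ∧ (∀ c, G₂ c ∈ admissibleVacuumData X) ∧ ∃ K : Set X, IsCompact K ∧ ∀ c, ∀ x ∉ K, (G₂
    c).h.inner x = d.h.inner x ∧ (G₂ c).k x = d.k x) → (∀ c, G₂ (L' c) = G₁ c) → ∃ U : Set
    (EuclideanSpace ℝ (Fin p)), IsOpen U ∧ Dense U ∧ ∀ v ∈ U, ∃ δ : ℝ, 0 < δ ∧ ∀ t : ℝ, t ≠ 0 → |t|
    < δ → Q₁ (G₂ (t • v))) → (∀ (m : ℕ) (G : EuclideanSpace ℝ (Fin m) → InitialDataSet (𝓡 3) X),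
    (InitialDataSet.IsSmoothDataFamily m G ∧ G 0 = d ∧ (∀ c, G c ∈ admissibleVacuumData X) ∧ ∃ K :
    Set X, IsCompact K ∧ ∀ c, ∀ x ∉ K, (G c).h.inner x = d.h.inner x ∧ (G c).k x = d.k x) → ∃ (n :
    ℕ) (G₁ : EuclideanSpace ℝ (Fin n) → InitialDataSet (𝓡 3) X) (L : EuclideanSpace ℝ (Fin m) →ₗ[ℝ]
    EuclideanSpace ℝ (Fin n)), Function.Injective L ∧ (InitialDataSet.IsSmoothDataFamily n G₁ ∧ G₁ 0
    = d ∧ (∀ c, G₁ c ∈ admissibleVacuumData X) ∧ ∃ K : Set X, IsCompact K ∧ ∀ c, ∀ x ∉ K, (G₁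
    c).h.inner x = d.h.inner x ∧ (G₁ c).k x = d.k x) ∧ (∀ c, G₁ (L c) = G c) ∧ ∀ (p : ℕ) (G₂ :
    EuclideanSpace ℝ (Fin p) → InitialDataSet (𝓡 3) X) (L' : EuclideanSpace ℝ (Fin n) →ₗ[ℝ]
    EuclideanSpace ℝ (Fin p)), Function.Injective L' → (InitialDataSet.IsSmoothDataFamily p G₂ ∧ G₂
    0 = d ∧ (∀ c, G₂ c ∈ admissibleVacuumData X) ∧ ∃ K : Set X, IsCompact K ∧ ∀ c, ∀ x ∉ K, (G₂
    c).h.inner x = d.h.inner x ∧ (G₂ c).k x = d.k x) → (∀ c, G₂ (L' c) = G₁ c) → ∃ U : Set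
    (EuclideanSpace ℝ (Fin p)), IsOpen U ∧ Dense U ∧ ∀ v ∈ U, ∃ δ : ℝ, 0 < δ ∧ ∀ t : ℝ, t ≠ 0 → |t|
    < δ → Q₂ (G₂ (t • v))) → ∀ (m : ℕ) (G : EuclideanSpace ℝ (Fin m) → InitialDataSet (𝓡 3) X),
    (InitialDataSet.IsSmoothDataFamily m G ∧ G 0 = d ∧ (∀ c, G c ∈ admissibleVacuumData X) ∧ ∃ K :
    Set X, IsCompact K ∧ ∀ c, ∀ x ∉ K, (G c).h.inner x = d.h.inner x ∧ (G c).k x = d.k x) → ∃ (n :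
    ℕ) (G₁ : EuclideanSpace ℝ (Fin n) → InitialDataSet (𝓡 3) X) (L : EuclideanSpace ℝ (Fin m) →ₗ[ℝ]
    EuclideanSpace ℝ (Fin n)), Function.Injective L ∧ (InitialDataSet.IsSmoothDataFamily n G₁ ∧ G₁ 0
    = d ∧ (∀ c, G₁ c ∈ admissibleVacuumData X) ∧ ∃ K : Set X, IsCompact K ∧ ∀ c, ∀ x ∉ K, (G₁
    c).h.inner x = d.h.inner x ∧ (G₁ c).k x = d.k x) ∧ (∀ c, G₁ (L c) = G c) ∧ ∀ (p : ℕ) (G₂ :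
    EuclideanSpace ℝ (Fin p) → InitialDataSet (𝓡 3) X) (L' : EuclideanSpace ℝ (Fin n) →ₗ[ℝ]
    EuclideanSpace ℝ (Fin p)), Function.Injective L' → (InitialDataSet.IsSmoothDataFamily p G₂ ∧ G₂
    0 = d ∧ (∀ c, G₂ c ∈ admissibleVacuumData X) ∧ ∃ K : Set X, IsCompact K ∧ ∀ c, ∀ x ∉ K, (G₂
    c).h.inner x = d.h.inner x ∧ (G₂ c).k x = d.k x) → (∀ c, G₂ (L' c) = G₁ c) → ∃ U : Set
    (EuclideanSpace ℝ (Fin p)), IsOpen U ∧ Dense U ∧ ∀ v ∈ U, ∃ δ : ℝ, 0 < δ ∧ ∀ t : ℝ, t ≠ 0 → |t|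
    < δ → (Q₁ (G₂ (t • v)) ∧ Q₂ (G₂ (t • v))) := by
  intro X _ _ _ _ _ _ d Q₁ Q₂ h₁ h₂ m G hG
  obtain ⟨n₁, G₁, L₁, hL₁, hT₁, hGL₁, hR₁⟩ := h₁ m G hG
  obtain ⟨n₂, G₂, L₂, hL₂, hT₂, hGL₂, hR₂⟩ := h₂ n₁ G₁ hT₁
  refine ⟨n₂, G₂, L₂.comp L₁, fun a b h => hL₁ (hL₂ h), hT₂,
    fun c => by rw [LinearMap.comp_apply, hGL₂, hGL₁], fun p G₃ L' hL' hT₃ hGL₃ => ?_⟩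
  obtain ⟨U₁, hU₁o, hU₁d, hU₁⟩ := hR₁ p G₃ (L'.comp L₂) (fun a b h => hL₂ (hL' h)) hT₃
    (fun c => by rw [LinearMap.comp_apply, hGL₃, hGL₂])
  obtain ⟨U₂, hU₂o, hU₂d, hU₂⟩ := hR₂ p G₃ L' hL' hT₃ hGL₃
  refine ⟨U₁ ∩ U₂, hU₁o.inter hU₂o, hU₁d.inter_of_isOpen_right hU₂d hU₂o, fun v hv => ?_⟩
  obtain ⟨δ₁, hδ₁, hv₁⟩ := hU₁ v hv.1
  obtain ⟨δ₂, hδ₂, hv₂⟩ := hU₂ v hv.2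
  exact ⟨min δ₁ δ₂, lt_min hδ₁ hδ₂, fun t ht htδ =>
    ⟨hv₁ t ht (htδ.trans_le (min_le_left _ _)), hv₂ t ht (htδ.trans_le (min_le_right _ _))⟩⟩

end Summit.FinalStateConjecture.FinalStateConjecture.Theorems.PhotonSphereChannels.TameCensorshipUnwind

end
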